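import Summits.QuantumFields.YangMills.Theorems.SwapVirialDeficitBlowUpGnomonicBFibreRescaledSockets
import Summits.QuantumFields.YangMills.Theorems.SwapVirialDeficitSectorLaplaceBTubeFibred
import Summits.QuantumFields.YangMills.Theorems.SwapVirialDeficitQuantitativeLaplaceDetComparison
import HarnessLib

/-!
# STUB (S-B) OF SKELETON ➎: THE FIBRED √b LAW OF THE STRATUM-B TUBES IN THE RESCALED LETTER, uniform on `{|u| ≥ τ}` — sockets DISCHARGED except the
# far floor and the `|u|`-uniform cubic constant
# (free-hands support of ⟨stmt-QuantumFields-24197⟩ `SwapVirialDeficit.SwapGluedStiffness` ∕ ⟨24194⟩; cell ym-idea-1, LEAD memo7 §E(3); w3 g66 floors, fcl-p3 g47 K7d jets, w2 wiring)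

✓`bTube_fibred_cylinder` had EVERY analytic input as a hypothesis.  Here the operators, their symmetry ∕ measurability ∕ ray identity, the UNIFORM coercivity
`λ_B(τ) = τ²∕((1+τ²)·12375·L¹⁰)` on `{τ² ≤ |u|²}`, the cubic identity, the amplitude `w₀(u)(1+e′)` with `w₀(u) = w(0,u₁,u₂)√(1+|u|²) = (1+|u|²)^{−3∕2}` and the tube chart
identity all come from ✓`bFibre_rescaled_sockets` ∕ ✓`volume_muB_restrict_scaledBTube_eq_map`; what stays a hypothesis is (i) the cubic CONSTANT `A₃` on the base set
(`1136016L⁴‖D_u y‖³ ≤ A₃‖y‖³` — `A₃ = 1136016L⁴(1+M²)^{3∕2}` on `{|u| ≤ M}` by `norm_gnoScaleB_le`, or `|u|`-free from g47's K7e) and (ii) the FAR FLOOR off the scaled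
tube (w3-type global floor).  The `δ`-window `W ⊇ [−R, R]` is any measurable set (✓`BTube L τ` has `W = {4δ²∕(1+δ²)² < τ ≤ (1+δ²)⁻¹, |δ| < τ√(1+δ²)}`).
* `norm_gnoScaleB_le` (`‖D_u y‖ ≤ √(1+|u|²)‖y‖`), `abs_delta_gnoScaleBChart_le`, `base_gnoScaleBChart`, `measurableSet_windowCylinder`, `det_ge_pow_of_coercive`;
* ★★★ `bTube_fibred_scaled_cylinder (ε) (hz) (hε) (hτ) (hτ1)` — ∃ operators `A′` (symmetric, ray identity, `λ_B`-coercive and `det A′_u ≥ λ_B^{m_B}` on `{τ² ≤ |u|²}`) such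
  that for EVERY measurable `S ⊆ {τ² ≤ |u|²}` with a point, measurable window `W ⊇ [−R,R]`, `0 < R`, `A₃R ≤ λ_B∕(8(m_B+8))`, `2R² ≤ 1`, `0 < b`, cubic constant and far floor:
  `|∫_{W-cyl(S)} e^{−bF_B} dμ_B − (2π∕b)^{m_B∕2}∫_S w₀∕√det A′| ≤ (K₃∕√b + 16(m_B+8)∕(λ_B R² b))·(2π∕b)^{m_B∕2}∫_S w₀∕√det A′ + e^{−bλ_B R²}·μ_B(X)`.

HONEST LABEL: (S-B) is NOT closed (far floor, `A₃` uniformity, the action-integral ∕ log-law step and the reading on `chartMeasure L` over ✓`BTube L τ` remain); (S-core),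
(S-001), ⟨24197⟩ ∕ ⟨24194⟩ OPEN; own crux ⟨22884⟩ OPEN (blocked-on ⟨19935⟩); the Yang–Mills mass gap is NOT proved; no summit is proved by a line.  THEOREMS ONLY
(0 `def`, 0 `sorry`), standard axioms.  Width seat ym-line-sfw-p2-w2 g59 (cell ym-idea-1, free hands), `--supports stmt-QuantumFields-24197`.
References: [cite: Luscher1983, §2]; [cite: HasenpflugRudolfSprungk2024, App. 4.1 Thm 16]; [cite: Breitung1994, Lemma 26 (2.102), p. 30]; [folklore].
-/

set_option autoImplicit false
set_option synthInstance.maxSize 1024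

noncomputable section

open MeasureTheory Quaternion Set Metric Module
open scoped Quaternion BigOperators ENNReal InnerProductSpace
open Literature.MathematicalPhysics.QuantumLattice
open Literature.MathematicalPhysics.QuantumFieldTheory hiding SU2
open Literature.Analysis.Asymptotics (det_pos_of_inner_pos)

namespace Summit.QuantumFields.YangMills.Theorems.SwapVirialDeficit.BlowUpRing

open Summit.QuantumFields.YangMills.Theorems.FemtoTransferGap
open Summit.QuantumFields.YangMills.Theorems.FemtoTransferGap.TT
open Summit.QuantumFields.YangMills.Theorems.VirialFluxGap.RingDeficit
open Summit.QuantumFields.YangMills.Theorems.SwapVirialDeficit.SwapRing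
open Summit.QuantumFields.YangMills.Theorems.SwapVirialDeficit.Gnomonic (normSq3 normSq3_nonneg gnomonicWeight gnomonicWeight_pos)
open Summit.QuantumFields.YangMills.Theorems.QuantitativeLaplace (laplaceMethod_quantitative_fibred_chart_cubic_offBound_on offTube_bound_of_cylinder
  det_le_det_of_inner_le inner_pos_of_coercive)

variable {L : ℕ} [NeZero L]

/-! ## §1 Small facts about the rescaled B-chart -/

/-- `‖D_u y‖ ≤ √(1+|u|²)·‖y‖` (all weights `≤ √(1+|u|²)`) — the cubic constant on a capped base `{|u| ≤ M}` is `1136016L⁴(1+M²)^{3∕2}`. [folklore] -/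
theorem norm_gnoScaleB_le (u : ℝ × ℝ) (y : GnoFibreB L) : ‖gnoScaleB u y‖ ≤ Real.sqrt (1 + (u.1 ^ 2 + u.2 ^ 2)) * ‖y‖ := by
  have hc0 : 0 ≤ Real.sqrt (1 + (u.1 ^ 2 + u.2 ^ 2)) := Real.sqrt_nonneg _
  have hc1 : 1 ≤ Real.sqrt (1 + (u.1 ^ 2 + u.2 ^ 2)) := Real.one_le_sqrt.2 (by nlinarith [sq_nonneg u.1, sq_nonneg u.2])
  have hle : ∀ i, gnoFibreBScale (L := L) u i ≤ Real.sqrt (1 + (u.1 ^ 2 + u.2 ^ 2)) := by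
    obtain ⟨h0, h1, h2, hj, hk, hf⟩ := gnoFibreBScale_apply (L := L) u
    intro i
    rcases i with ((j | j) | (k | fk))
    · fin_cases j
      · exact h0 ▸ hc1
      · exact le_rfl
      · exact h2 ▸ hc1
    · exact (hj j) ▸ hc1
    · exact (hk k) ▸ hc1
    · exact (hf fk) ▸ hc1
  have h : ‖gnoScaleB u y‖ ^ 2 ≤ (Real.sqrt (1 + (u.1 ^ 2 + u.2 ^ 2)) * ‖y‖) ^ 2 := by
    rw [mul_pow, EuclideanSpace.real_norm_sq_eq, EuclideanSpace.real_norm_sq_eq, Finset.mul_sum]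
    refine Finset.sum_le_sum fun i _ => ?_
    rw [gnoScaleB_apply, mul_pow]
    have h1 : gnoFibreBScale (L := L) u i ^ 2 ≤ Real.sqrt (1 + (u.1 ^ 2 + u.2 ^ 2)) ^ 2 :=
      pow_le_pow_left₀ (gnoFibreBScale_pos u i).le (hle i) 2
    exact mul_le_mul_of_nonneg_right h1 (sq_nonneg _)
  exact (pow_le_pow_iff_left₀ (norm_nonneg _) (mul_nonneg hc0 (norm_nonneg _)) two_ne_zero).1 h

/-- The hub letter of `Ψ′_B(u, y)` is `y_δ` (weight `1`), bounded by `‖y‖`. [folklore] -/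
theorem abs_delta_gnoScaleBChart_le (u : ℝ × ℝ) (y : GnoFibreB L) : |(gnoFibreBEquiv (u, gnoScaleB u y)).1| ≤ ‖y‖ := by
  rw [gnoFibreBEquiv_gnoScaleB]
  show |y (Sum.inl (Sum.inl 0))| ≤ ‖y‖
  have h1 : y (Sum.inl (Sum.inl 0)) ^ 2 ≤ ‖y‖ ^ 2 := by
    rw [norm_sq_gnoFibreB_letters]
    nlinarith [sq_nonneg (y (Sum.inl (Sum.inl 1))), sq_nonneg (y (Sum.inl (Sum.inl 2))), sq_nonneg (y (Sum.inl (Sum.inr 0))), sq_nonneg (y (Sum.inl (Sum.inr 1))),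
      normSq3_nonneg (fun k => y (Sum.inr (Sum.inl k))), Finset.sum_nonneg fun f (_ : f ∈ Finset.univ) => normSq3_nonneg (fun k => y (Sum.inr (Sum.inr (f, k))))]
  exact abs_le_of_sq_le_sq' h1 (norm_nonneg y) |> fun h => abs_le.2 h

/-- The base letters of `Ψ′_B(u, y)` are `u`. [folklore] -/
theorem base_gnoScaleBChart (u : ℝ × ℝ) (y : GnoFibreB L) :
    ((gnoFibreBEquiv (u, gnoScaleB u y)).2.1.1 1, (gnoFibreBEquiv (u, gnoScaleB u y)).2.1.1 2) = u := by
  rw [gnoFibreBEquiv_gnoScaleB]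
  simp

/-- The window-cylinder `{δ ∈ W} ∩ {(η_x 1, η_x 2) ∈ S}` is measurable. [folklore] -/
theorem measurableSet_windowCylinder {S : Set (ℝ × ℝ)} (hS : MeasurableSet S) {W : Set ℝ} (hW : MeasurableSet W) :
    MeasurableSet ({p : ℝ × GnoCoord L | p.1 ∈ W} ∩ {p : ℝ × GnoCoord L | (p.2.1.1 1, p.2.1.1 2) ∈ S}) := by
  refine (measurable_fst hW).inter ?_
  rw [← gnoFibreBEquiv_image_prod_univ]
  exact measurableSet_cylinderB hS

omit [NeZero L] in
/-- `det A ≥ λ^m` for a symmetric `λ`-coercive operator (✓`det_le_det_of_inner_le` against `λ·id`). [cite: Breitung1994, Lemma 26 (2.102), p. 30] -/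
theorem det_ge_pow_of_coercive {V : Type*} [NormedAddCommGroup V] [InnerProductSpace ℝ V] [FiniteDimensional ℝ V] [MeasurableSpace V] [BorelSpace V]
    {A : V →ₗ[ℝ] V} (hA : A.IsSymmetric) {lam : ℝ} (hlam : 0 < lam) (hcoer : ∀ y : V, lam * ‖y‖ ^ 2 ≤ ⟪A y, y⟫_ℝ) :
    lam ^ finrank ℝ V ≤ LinearMap.det A := by
  have hI : (lam • (LinearMap.id : V →ₗ[ℝ] V)).IsSymmetric := fun x y => by
    simp only [LinearMap.smul_apply, LinearMap.id_coe, id_eq, real_inner_smul_left, real_inner_smul_right]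
  have hIq : ∀ y : V, ⟪(lam • (LinearMap.id : V →ₗ[ℝ] V)) y, y⟫_ℝ = lam * ‖y‖ ^ 2 := fun y => by
    simp only [LinearMap.smul_apply, LinearMap.id_coe, id_eq, real_inner_smul_left, real_inner_self_eq_norm_sq]
  have h := det_le_det_of_inner_le hI hA hlam (fun y => by rw [hIq]) (fun y => by rw [hIq]; exact hcoer y)
  rwa [LinearMap.det_smul, LinearMap.det_id, mul_one] at h

/-! ## §2 The B-tube law in the rescaled letter -/

/-- ★★★ **THE FIBRED √b LAW OF THE STRATUM-B TUBES IN THE RESCALED `x₀`-LETTER, UNIFORM ON `{|u| ≥ τ}`** (principal signs `ε_z = +`, followers `+`; `0 < τ ≤ 1`).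
There are operators `A′_u` on `V_B` (symmetric; RAY identity `⟪A′_u y,y⟫ = (d²∕ds²)F_B(gnoBaseB u + s·gnoFibreBEmb(gnoScaleB u y))|₀`; `λ_B‖y‖² ≤ ⟪A′_u y,y⟫` and
`λ_B^{m_B} ≤ det A′_u` for `τ² ≤ |u|²`, `λ_B = τ²∕((1+τ²)·12375·L¹⁰)`) such that for every measurable base set `S ⊆ {τ² ≤ |u|²}` with a point, measurable `δ`-window
`W ⊇ [−R, R]`, radius `0 < R` with `A₃R ≤ λ_B∕(8(m_B+8))` and `2R·R ≤ 1`, `0 < b`, a cubic constant `A₃` on `S` (`1136016L⁴‖D_u y‖³ ≤ A₃‖y‖³` on the tube) and a far floor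
`λ_B R² ≤ F_B` on the window-cylinder off the scaled tube:
`|∫_{{δ∈W}∩{u∈S}} e^{−bF_B} dμ_B − (2π∕b)^{m_B∕2}∫_S w₀∕√det A′| ≤ (K₃∕√b + 16(m_B+8)∕(λ_B R²b))·(2π∕b)^{m_B∕2}∫_S w₀∕√det A′ + e^{−bλ_B R²}·μ_B(X)`,
`w₀(u) = w(0,u₁,u₂)·√(1+|u|²)`, `K₃ = 16A₃(m_B+8)∕λ_B + 256A₃(m_B+8)²∕λ_B² + 2R + 16R(m_B+8)∕λ_B`.
[cite: Luscher1983, §2] [cite: HasenpflugRudolfSprungk2024, App. 4.1 Thm 16] -/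
theorem bTube_fibred_scaled_cylinder (ε : GnoSign L) (hz : ε.2.1 = true) (hε : ε.2.2 = fun _ => true) {τ : ℝ} (hτ : 0 < τ) (hτ1 : τ ≤ 1) :
    ∃ A' : ℝ × ℝ → GnoFibreB L →ₗ[ℝ] GnoFibreB L,
      (∀ u, (A' u).IsSymmetric) ∧
      (∀ u (y : GnoFibreB L), ⟪A' u y, y⟫_ℝ =
        iteratedDeriv 2 (fun s : ℝ => gnoDeficit (fun _ => false) (fun _ => 1) (hubAt (gnoBaseB u + s • gnoFibreBEmb (gnoScaleB u y)).1 1) ε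
          (gnoBaseB u + s • gnoFibreBEmb (gnoScaleB u y)).2) 0) ∧
      (∀ u : ℝ × ℝ, τ ^ 2 ≤ u.1 ^ 2 + u.2 ^ 2 → ∀ y : GnoFibreB L, τ ^ 2 / ((1 + τ ^ 2) * (12375 * (L : ℝ) ^ 10)) * ‖y‖ ^ 2 ≤ ⟪A' u y, y⟫_ℝ) ∧
      (∀ u : ℝ × ℝ, τ ^ 2 ≤ u.1 ^ 2 + u.2 ^ 2 → (τ ^ 2 / ((1 + τ ^ 2) * (12375 * (L : ℝ) ^ 10))) ^ finrank ℝ (GnoFibreB L) ≤ LinearMap.det (A' u)) ∧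
      ∀ {S : Set (ℝ × ℝ)}, MeasurableSet S → S ⊆ {u : ℝ × ℝ | τ ^ 2 ≤ u.1 ^ 2 + u.2 ^ 2} → ∀ {p₀ : ℝ × ℝ}, p₀ ∈ S →
      ∀ {W : Set ℝ}, MeasurableSet W → ∀ {R A₃ b : ℝ}, 0 < R → Icc (-R) R ⊆ W → 0 ≤ A₃ → 0 < b →
        A₃ * R ≤ τ ^ 2 / ((1 + τ ^ 2) * (12375 * (L : ℝ) ^ 10)) / (8 * ((finrank ℝ (GnoFibreB L) : ℝ) + 8)) → 2 * R * R ≤ 1 →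
        (∀ u ∈ S, ∀ y : GnoFibreB L, ‖y‖ ≤ R → 1136016 * (L : ℝ) ^ 4 * ‖gnoScaleB u y‖ ^ 3 ≤ A₃ * ‖y‖ ^ 3) →
        (∀ u ∈ S, ∀ y : GnoFibreB L, R ≤ ‖y‖ → (gnoFibreBEquiv (u, gnoScaleB u y)).1 ∈ W →
          τ ^ 2 / ((1 + τ ^ 2) * (12375 * (L : ℝ) ^ 10)) * R ^ 2 ≤
            gnoDeficit (fun _ => false) (fun _ => 1) (hubAt (gnoFibreBEquiv (u, gnoScaleB u y)).1 1) ε (gnoFibreBEquiv (u, gnoScaleB u y)).2) →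
        |(∫ p in {p : ℝ × GnoCoord L | p.1 ∈ W} ∩ {p : ℝ × GnoCoord L | (p.2.1.1 1, p.2.1.1 2) ∈ S},
              Real.exp (-(b * gnoDeficit (fun _ => false) (fun _ => 1) (hubAt p.1 1) ε p.2))
              ∂((volume : Measure (ℝ × GnoCoord L)).withDensity fun p => ENNReal.ofReal (((1 + p.1 ^ 2)⁻¹) ^ 2 * gnoDensity p.2))) -
            (2 * Real.pi / b) ^ ((finrank ℝ (GnoFibreB L) : ℝ) / 2) *
              ∫ u in S, gnomonicWeight (![0, u.1, u.2] : Fin 3 → ℝ) * Real.sqrt (1 + (u.1 ^ 2 + u.2 ^ 2)) / Real.sqrt (LinearMap.det (A' u))| ≤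
          ((16 * A₃ * ((finrank ℝ (GnoFibreB L) : ℝ) + 8) / (τ ^ 2 / ((1 + τ ^ 2) * (12375 * (L : ℝ) ^ 10))) +
                  256 * A₃ * ((finrank ℝ (GnoFibreB L) : ℝ) + 8) ^ 2 / (τ ^ 2 / ((1 + τ ^ 2) * (12375 * (L : ℝ) ^ 10))) ^ 2 + 2 * R +
                  8 * (2 * R) * ((finrank ℝ (GnoFibreB L) : ℝ) + 8) / (τ ^ 2 / ((1 + τ ^ 2) * (12375 * (L : ℝ) ^ 10)))) / Real.sqrt b +
              16 * ((finrank ℝ (GnoFibreB L) : ℝ) + 8) / (τ ^ 2 / ((1 + τ ^ 2) * (12375 * (L : ℝ) ^ 10)) * R ^ 2) / b) *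
            ((2 * Real.pi / b) ^ ((finrank ℝ (GnoFibreB L) : ℝ) / 2) *
              ∫ u in S, gnomonicWeight (![0, u.1, u.2] : Fin 3 → ℝ) * Real.sqrt (1 + (u.1 ^ 2 + u.2 ^ 2)) / Real.sqrt (LinearMap.det (A' u))) +
          Real.exp (-(b * (τ ^ 2 / ((1 + τ ^ 2) * (12375 * (L : ℝ) ^ 10)) * R ^ 2))) *
            ((volume : Measure (ℝ × GnoCoord L)).withDensity fun p => ENNReal.ofReal (((1 + p.1 ^ 2)⁻¹) ^ 2 * gnoDensity p.2)).real univ := by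
  obtain ⟨A, ρ, e, hAs, hAm, hρm, hem, hray, hcoer, hf, hρb, hw, heb⟩ := bFibre_rescaled_sockets (L := L) ε hz hε hτ hτ1
  have hL : (0 : ℝ) < (L : ℝ) := by exact_mod_cast NeZero.pos L
  set lam : ℝ := τ ^ 2 / ((1 + τ ^ 2) * (12375 * (L : ℝ) ^ 10)) with hlam
  have hlam0 : 0 < lam := by positivity
  have hdet : ∀ u : ℝ × ℝ, τ ^ 2 ≤ u.1 ^ 2 + u.2 ^ 2 → lam ^ finrank ℝ (GnoFibreB L) ≤ LinearMap.det (A u) := fun u hu =>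
    det_ge_pow_of_coercive (hAs u) hlam0 (hcoer u hu)
  refine ⟨A, hAs, hray, hcoer, hdet, ?_⟩
  intro S hS hSτ p₀ hp₀ W hW R A₃ b hR hRW hA₃ hb hsmall hDR hcubic hfar
  -- the measure space and the letters
  set μB : Measure (ℝ × GnoCoord L) := (volume : Measure (ℝ × GnoCoord L)).withDensity fun p => ENNReal.ofReal (((1 + p.1 ^ 2)⁻¹) ^ 2 * gnoDensity p.2) with hμB
  haveI : IsFiniteMeasure μB := isFiniteMeasure_muB
  set f : ℝ × GnoCoord L → ℝ := fun p => gnoDeficit (fun _ => false) (fun _ => 1) (hubAt p.1 1) ε p.2 with hfdef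
  have hfm : Measurable f := measurable_bDeficit _ _ ε
  set Rg : Set (ℝ × GnoCoord L) := {p : ℝ × GnoCoord L | p.1 ∈ W} ∩ {p : ℝ × GnoCoord L | (p.2.1.1 1, p.2.1.1 2) ∈ S} with hRg
  have hRgm : MeasurableSet Rg := measurableSet_windowCylinder hS hW
  set φ : ℝ × GnoCoord L → ℝ := Rg.indicator (fun _ => (1 : ℝ)) with hφ
  have hφm : Measurable φ := measurable_const.indicator hRgm
  set Ψ' : (ℝ × ℝ) × GnoFibreB L → ℝ × GnoCoord L := fun q => gnoFibreBEquiv (q.1, gnoScaleB q.1 q.2) with hΨ'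
  obtain ⟨hTm, hchart⟩ := volume_muB_restrict_scaledBTube_eq_map (L := L) hS R
  have hΨm : Measurable Ψ' := measurable_gnoScaleBChart (L := L)
  have hJm : Measurable fun q : (ℝ × ℝ) × GnoFibreB L =>
      (∏ i, |gnoFibreBScale (L := L) q.1 i|) * (((1 + (gnoFibreBEquiv (q.1, gnoScaleB q.1 q.2)).1 ^ 2)⁻¹) ^ 2 * gnoDensity (gnoFibreBEquiv (q.1, gnoScaleB q.1 q.2)).2) :=
    (Finset.measurable_prod _ fun i _ => ((measurable_gnoFibreBScale i).comp measurable_fst).abs).mul (measurable_bDensity.comp (measurable_gnoScaleBChart (L := L)))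
  have hJ0 : ∀ q ∈ S ×ˢ closedBall (0 : GnoFibreB L) R,
      0 ≤ (∏ i, |gnoFibreBScale (L := L) q.1 i|) * (((1 + (gnoFibreBEquiv (q.1, gnoScaleB q.1 q.2)).1 ^ 2)⁻¹) ^ 2 * gnoDensity (gnoFibreBEquiv (q.1, gnoScaleB q.1 q.2)).2) :=
    fun q _ => mul_nonneg (Finset.prod_nonneg fun i _ => abs_nonneg _) (bDensity_pos _).le
  obtain ⟨hw0pos, hw0m, hw0i⟩ := bBaseWeight_facts
  -- coercivity and the cubic constant on `S`
  have hcoerS : ∀ u ∈ S, ∀ y : GnoFibreB L, lam * ‖y‖ ^ 2 ≤ ⟪A u y, y⟫_ℝ := fun u hu y => hcoer u (hSτ hu) y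
  have hρS : ∀ u ∈ S, ∀ y : GnoFibreB L, ‖y‖ ≤ R → |ρ (u, y)| ≤ A₃ * ‖y‖ ^ 3 := fun u hu y hy => (hρb u y).trans (hcubic u hu y hy)
  -- membership of tube points in the window-cylinder
  have hmemRg : ∀ u ∈ S, ∀ y : GnoFibreB L, ‖y‖ ≤ R → Ψ' (u, y) ∈ Rg := by
    intro u hu y hy
    refine ⟨?_, ?_⟩
    · show (gnoFibreBEquiv (u, gnoScaleB u y)).1 ∈ W
      have h := abs_delta_gnoScaleBChart_le (L := L) u y
      exact hRW ⟨by linarith [(abs_le.1 (h.trans hy)).1], (abs_le.1 (h.trans hy)).2⟩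
    · show ((gnoFibreBEquiv (u, gnoScaleB u y)).2.1.1 1, (gnoFibreBEquiv (u, gnoScaleB u y)).2.1.1 2) ∈ S
      rw [base_gnoScaleBChart]; exact hu
  -- `hw` with the cut-off `φ`
  have hw' : ∀ u ∈ S, ∀ y : GnoFibreB L, ‖y‖ ≤ R →
      (∏ i, |gnoFibreBScale (L := L) u i|) * (((1 + (gnoFibreBEquiv (u, gnoScaleB u y)).1 ^ 2)⁻¹) ^ 2 * gnoDensity (gnoFibreBEquiv (u, gnoScaleB u y)).2) *
          φ (Ψ' (u, y)) = gnomonicWeight (![0, u.1, u.2] : Fin 3 → ℝ) * Real.sqrt (1 + (u.1 ^ 2 + u.2 ^ 2)) * (1 + e (u, y)) := by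
    intro u hu y hy
    rw [hφ, indicator_of_mem (hmemRg u hu y hy), ← hw u y]
  -- the off-tube bound
  have hoff : ∀ x, x ∉ Ψ' '' (S ×ˢ closedBall (0 : GnoFibreB L) R) → ‖Real.exp (-(b * (f x - 0))) * φ x‖ ≤ 1 * Real.exp (-(b * (lam * R ^ 2))) := by
    refine offTube_bound_of_cylinder (C := Rg) hb.le (fun x hx => by rw [hφ, indicator_of_notMem hx]) zero_le_one
      (fun x hx => by rw [hφ, indicator_of_mem hx, abs_one]) fun x hx hxT => ?_
    have hcyl : x ∈ Ψ' '' (S ×ˢ (univ : Set (GnoFibreB L))) := by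
      rw [hΨ', gnoScaleBChart_image_prod_univ]; exact hx.2
    obtain ⟨u, hu, y, hRy, rfl⟩ := exists_of_mem_cylinderB_not_mem_scaledTube hcyl hxT
    rw [zero_add, hfdef]
    exact hfar u hu y hRy.le hx.1
  -- apply the generic law
  obtain ⟨-, hbd⟩ := laplaceMethod_quantitative_fibred_chart_cubic_offBound_on (X := ℝ × GnoCoord L) (μ := μB) (M := ℝ × ℝ) (ν := volume) (V := GnoFibreB L)
    (Ψ := Ψ') (J := fun q => (∏ i, |gnoFibreBScale (L := L) q.1 i|) *
      (((1 + (gnoFibreBEquiv (q.1, gnoScaleB q.1 q.2)).1 ^ 2)⁻¹) ^ 2 * gnoDensity (gnoFibreBEquiv (q.1, gnoScaleB q.1 q.2)).2)) (f := f) (φ := φ) (f₀ := 0)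
    hS hp₀ (A := A) (fun u _ => hAs u) hlam0 hcoerS hAm (R := R) (A₃ := A₃) (D := 2 * R) (β := b) (Eoff := 1 * Real.exp (-(b * (lam * R ^ 2))))
    hR hA₃ (by positivity) hb hsmall hDR hΨm hTm hJm hJ0 hchart hfm hφm hρm hem hw0m (fun u _ => (hw0pos u).le) hw0i.integrableOn
    hρS (fun u _ y hy => heb R hR.le u y hy) (fun u _ y _ => hf u y) hw' (by positivity) (Filter.Eventually.of_forall hoff)
  -- read back: the cut-off integral is the set integral over the window-cylinder
  rw [one_mul] at hbd
  have hlhs : ∫ x, Real.exp (-(b * (f x - 0))) * φ x ∂μB = ∫ p in Rg, Real.exp (-(b * f p)) ∂μB := by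
    rw [← integral_indicator hRgm]
    refine integral_congr_ae (Filter.Eventually.of_forall fun x => ?_)
    show Real.exp (-(b * (f x - 0))) * φ x = Rg.indicator (fun p => Real.exp (-(b * f p))) x
    by_cases hx : x ∈ Rg
    · rw [hφ, indicator_of_mem hx, indicator_of_mem hx, sub_zero, mul_one]
    · rw [hφ, indicator_of_notMem hx, indicator_of_notMem hx, mul_zero]
  rw [hlhs] at hbd
  exact hbd

end Summit.QuantumFields.YangMills.Theorems.SwapVirialDeficit.BlowUpRing

end
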